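import Literature.Geometry.Lorentzian.RelativeDevelopmentGluingCauchy
import HarnessLib

/-!
# Cauchy hypersurfaces are preserved by time-orientation preserving isometric embeddings

Let `Φ : (N, g_N, τ_N) → (M, g, τ)` be a time-orientation preserving isometric immersion between
time-oriented Lorentzian manifolds (`PseudoRiemannianMetric.IsIsometricImmersion`,
`TimeOrientation.PreservesTimeOrientation`) admitting a continuous left inverse `Ψ : M → N`,
`Ψ ∘ Φ = id` (e.g. an isometric diffeomorphism, or an isometric open embedding onto an open
sub-spacetime together with the inverse on its image). **If `S ⊆ M` is a Cauchy hypersurface of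
`(M, g, τ)`, then `Φ⁻¹(S)` is a Cauchy hypersurface of `(N, g_N, τ_N)`**
(`LorentzianMetric.IsCauchyHypersurface.preimage_of_isIsometricImmersion`): an endless timelike
curve `γ` of `N` is carried by `Φ` to a timelike curve of `M`
(`IsFutureTimelikeCurveOn.comp_isIsometricImmersion`, `RelativeDevelopmentGluingCauchy.lean`),
endless in `M`
(an endpoint `q` of `Φ ∘ γ` would make `Ψ q` an endpoint of `γ = Ψ ∘ Φ ∘ γ`), hence meeting `S`
exactly once — at the parameters where `γ` meets `Φ⁻¹(S)`.

This is the invariance of global hyperbolicity / of the Cauchy property under isometries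
(O'Neill 1983, Ch. 14, p. 402 and Def. 14.28: the notions are defined from the causal structure,
which isometries preserve), in the one-sided form that also covers the transport of a Cauchy
hypersurface between two realisations of the same open sub-spacetime (`CommonDevelopmentSymm`:
`isCauchyHypersurface_rangeOpens` is the instance `Φ = ψ⁻¹`, `Ψ = ψ`).

Everything is proved; no definitions, no named facts (D-0026).

## References

* B. O'Neill, *Semi-Riemannian geometry with applications to relativity*, Academic Press 1983,
  Ch. 3, pp. 90–91 (isometries), Ch. 14, p. 402 and Def. 14.28 (Cauchy hypersurfaces).
  [ONeillSemiRiemannian1983]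
* J. Sbierski, Ann. Henri Poincaré 17 (2016) 301–329 = arXiv:1309.7591v3, §2, Remark 3 (2)
  (transport between the two realisations of a common development). [Sbierski2016AHP]
-/

noncomputable section

open Bundle Set Function Filter Topology
open scoped Manifold ContDiff Topology

namespace Literature.Geometry.Lorentzian

variable {E : Type*} [NormedAddCommGroup E] [NormedSpace ℝ E] {H : Type*} [TopologicalSpace H]
  {I : ModelWithCorners ℝ E H} {n : ℕ∞ω} {M : Type*} [TopologicalSpace M] [ChartedSpace H M]
  [IsManifold I ∞ M]
  {E' : Type*} [NormedAddCommGroup E'] [NormedSpace ℝ E'] {H' : Type*} [TopologicalSpace H']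
  {I' : ModelWithCorners ℝ E' H'} {N : Type*} [TopologicalSpace N] [ChartedSpace H' N]
  [IsManifold I' ∞ N]

namespace LorentzianMetric

variable {g : LorentzianMetric I n M} {τ : TimeOrientation g}
  {gN : LorentzianMetric I' n N} {τN : TimeOrientation gN}

/-- **Cauchy hypersurfaces pull back along time-orientation preserving isometric immersions with a
continuous left inverse.** Let `Φ : (N, g_N, τ_N) → (M, g, τ)` be a time-orientation preserving
isometric immersion and `Ψ : M → N` continuous with `Ψ ∘ Φ = id`. If `S` is a Cauchy hypersurface
of `(M, g, τ)`, then `Φ⁻¹(S)` is a Cauchy hypersurface of `(N, g_N, τ_N)`: an endless timelike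
curve `γ` of `N` gives the timelike curve `Φ ∘ γ` of `M`, endless (an endpoint `q` of `Φ ∘ γ`
would make `Ψ q` an endpoint of `γ`), which meets `S` exactly once. O'Neill 1983, Ch. 14, p. 402
and Def. 14.28 (causal notions are invariant under isometries); Sbierski 2016, §2, Remark 3 (2).
[cite: ONeillSemiRiemannian1983, Ch. 14, Def. 14.28 (p. 415) and p. 402] -/
theorem IsCauchyHypersurface.preimage_of_isIsometricImmersion (hn : n ≠ 0) {Φ : N → M}
    (hΦi : gN.IsIsometricImmersion g.toPseudoRiemannianMetric Φ)
    (hΦτ : τN.PreservesTimeOrientation Φ τ) {Ψ : M → N} (hΨc : Continuous Ψ)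
    (hΨΦ : ∀ x, Ψ (Φ x) = x) {S : Set M} (hS : g.IsCauchyHypersurface τ S) :
    gN.IsCauchyHypersurface τN (Φ ⁻¹' S) := by
  intro γ s hγ
  obtain ⟨hs, hγt, hγf, hγp⟩ := hγ
  have hΦd : MDifferentiable I' I Φ := hΦi.1.mdifferentiable hn
  have hγ't : g.IsFutureTimelikeCurveOn τ (Φ ∘ γ) s :=
    hγt.comp_isIsometricImmersion hΦd hΦτ hΦi.2
  have hback : Ψ ∘ (Φ ∘ γ) = γ := funext fun t ↦ hΨΦ (γ t)
  have hγ'f : IsFutureEndless (Φ ∘ γ) s := by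
    refine ⟨hγf.1, fun q hq ↦ hγf.2 (Ψ q) ?_⟩
    have h : HasFutureEndpoint (Ψ ∘ (Φ ∘ γ)) s (Ψ q) := (hΨc.tendsto q).comp hq
    rwa [hback] at h
  have hγ'p : IsPastEndless (Φ ∘ γ) s := by
    refine ⟨hγp.1, fun q hq ↦ hγp.2 (Ψ q) ?_⟩
    have h : HasPastEndpoint (Ψ ∘ (Φ ∘ γ)) s (Ψ q) := (hΨc.tendsto q).comp hq
    rwa [hback] at h
  obtain ⟨t₀, ⟨ht₀s, ht₀S⟩, huniq⟩ := hS (Φ ∘ γ) s ⟨hs, hγ't, hγ'f, hγ'p⟩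
  exact ⟨t₀, ⟨ht₀s, ht₀S⟩, fun t ht ↦ huniq t ⟨ht.1, ht.2⟩⟩

/-- **Cauchy hypersurfaces are transported by time-orientation preserving isometric
diffeomorphisms**: if `Φ : N → M` and `Ψ : M → N` are mutually inverse time-orientation
preserving isometric immersions, then `S ⊆ M` is a Cauchy hypersurface of `M` iff `Φ⁻¹(S)` is a
Cauchy hypersurface of `N`. O'Neill 1983, Ch. 14, p. 402 and Def. 14.28. [cite: ONeillSemiRiemannian1983, Ch. 14, Def. 14.28 (p. 415) and p. 402] -/
theorem isCauchyHypersurface_preimage_iff_of_isIsometricImmersion (hn : n ≠ 0) {Φ : N → M}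
    (hΦi : gN.IsIsometricImmersion g.toPseudoRiemannianMetric Φ)
    (hΦτ : τN.PreservesTimeOrientation Φ τ) {Ψ : M → N}
    (hΨi : g.IsIsometricImmersion gN.toPseudoRiemannianMetric Ψ)
    (hΨτ : τ.PreservesTimeOrientation Ψ τN)
    (hΨΦ : ∀ x, Ψ (Φ x) = x) (hΦΨ : ∀ y, Φ (Ψ y) = y) (S : Set M) :
    gN.IsCauchyHypersurface τN (Φ ⁻¹' S) ↔ g.IsCauchyHypersurface τ S := by
  refine ⟨fun h ↦ ?_, fun h ↦ h.preimage_of_isIsometricImmersion hn hΦi hΦτ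
    (hΨi.1.continuous) hΨΦ⟩
  have h2 := h.preimage_of_isIsometricImmersion hn hΨi hΨτ (hΦi.1.continuous) hΦΨ
  have hset : Ψ ⁻¹' (Φ ⁻¹' S) = S := by
    ext y
    simp only [mem_preimage, hΦΨ y]
  rwa [hset] at h2

end LorentzianMetric

end Literature.Geometry.Lorentzian

end
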